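import Summits.BirchSwinnertonDyer.BirchSwinnertonDyer.Theorems.Rank1ResidualJetWeilTransportConj
import Summits.BirchSwinnertonDyer.Rank1Residual.X11b.WeilTransport
import Summits.BirchSwinnertonDyer.Rank1Residual.X11b.BDPRouteRelaxation
import Literature.NumberTheory.EllipticCurves.SelmerGaloisActionPlaces
import HarnessLib

/-!
# Crux U1 `KolyvaginBoundedDefectAtTwo` (stmt-BirchSwinnertonDyer-28083), LINE 17 `regular_core_rigidity` v3,
# stub S1b `stub_nearCoreExistenceAtTwo` — INVARIANCE of the local Weil–Tate pairing `inv_v(x ∪_e y)` under the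
# complex conjugation `σ_* = conjActPlace` at a `σ`-fixed place (the in-situ input of the refill-sign lemma)

Width seat `bsd-line-krr2-p2` g14 (ONE READER on S1b); `--supports stmt-BirchSwinnertonDyer-28083` (helper). THEOREMS
ONLY; nothing here proves S1b, U1, a rung or BSD. BSD is NOT proved.

## What
For `W/ℚ`, a number field `K`, `σ ∈ Aut(K/ℚ)`, a place datum `h : σ • v = w`, a Weil datum `e` on `E[N](K̄)` that is
`Γ_K`-equivariant (`hgal`) and equivariant under the adapted lift `liftAutPlace σ h` (`hτe` — supplied for EVERY lift by
JET's `exists_weilPairing_liftEquivariant`), and a family of local invariant maps compatible with `σ_*`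
(`inv.IsConjCompatible σ` — a conjunct of the PROVED `poitouTate_selmerStructure_duality_conj_holds`):
* `invWeilPairing_conjActPlace` — `⟨σ_* x, σ_* y⟩_w = ⟨x, y⟩_v` for `⟨x, y⟩_v = inv_v (x ∪_e y)`
  (`X11b.Relaxation.invWeilPairing`), assembled from `X11b.LocBridge.localTatePairingZMod_map_weilDual`
  (`⟨x, y⟩ = ⟨x, H¹(w) y⟩_Tate`), `JET.GlobalDuality.map_weilDual_conjActPlace` (`H¹(w) ∘ σ_* = σ_*^D ∘ H¹(w)`) and
  `localTatePairingZMod_conjActPlace` (`⟨σ_* x, σ_*^D y'⟩_Tate = ⟨x, y'⟩_Tate`).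
At a `σ`-FIXED place (`w = v`, an inert Kolyvagin prime) this is the hypothesis `hσb` of
`RegularRefill.nsmul_add_smul_eq_zero_of_mem_lagrangian` (p684722): the refill of a pure `s`-step of the S1b walk is a
`(−s)`-eigen-subgroup up to the cut's defect.
References (locators only): [cite: Jetchev2008, §5 Thm. 5.1] [cite: MilneADT2006, Ch. I, Cor. 2.3]
[cite: CasselsFrohlichANT1967, Ch. VI §1.1] [cite: SilvermanAEC2009, Prop. III.8.1 (d)].
Design: no definitions; `K : Type u`; axioms `propext`, `Classical.choice`, `Quot.sound`.
-/

set_option autoImplicit false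
-- the Theorems namespace of this sub repeats the summit name by design (D-0017 nested layout)
set_option linter.dupNamespace false

noncomputable section

open scoped Classical
open Field WeierstrassCurve NumberField IsDedekindDomain
open Literature.NumberTheory.EllipticCurves Literature.NumberTheory.GaloisRepresentations
open Literature.NumberTheory.GaloisCohomology
open Literature.NumberTheory.GaloisRepresentations.DiscreteGaloisModule (localTatePairingZMod)
open Summit.BirchSwinnertonDyer.Rank1Residual.X11b.Relaxation (invWeilPairing invWeilPairing_apply)
open Summit.BirchSwinnertonDyer.Rank1Residual.X11b.LocBridge (localTatePairingZMod_map_weilDual)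
open Summit.BirchSwinnertonDyer.Rank1Residual.JET.GlobalDuality (map_weilDual_conjActPlace)

namespace Summit.BirchSwinnertonDyer.BirchSwinnertonDyer.Theorems.KolyvaginAtTwo.RegularRefill

universe u

variable {K : Type u} [Field K] [NumberField K] (W : WeierstrassCurve ℚ) (σ : K ≃ₐ[ℚ] K)
  (N : ℕ) [NeZero N] [(W.baseChange K).IsElliptic] [Finite (geomTorsion (W.baseChange K) N)]
  (e : geomTorsion (W.baseChange K) N → geomTorsion (W.baseChange K) N → AlgebraicClosure K)
  (hμ : ∀ S T, e S T ^ N = 1)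
  (hadd₁ : ∀ S₁ S₂ T, e (S₁ + S₂) T = e S₁ T * e S₂ T)
  (hadd₂ : ∀ S T₁ T₂, e S (T₁ + T₂) = e S T₁ * e S T₂)
  (hgal : ∀ (g : absoluteGaloisGroup K) (S T : geomTorsion (W.baseChange K) N),
    g • e S T = e (g • S) (g • T))
  (inv : LocalInvariants K N) (hinv : inv.IsConjCompatible σ)

include hinv in
/-- **`⟨σ_* x, σ_* y⟩_w = ⟨x, y⟩_v`** for the Weil–Tate pairing `⟨x, y⟩_v = inv_v (x ∪_e y)` on `H¹(K_v, E[N])`, a place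
datum `σ • v = w`, a Weil datum equivariant under the adapted lift, and invariant maps compatible with `σ_*`.
[cite: Jetchev2008, §5 Thm. 5.1] [cite: MilneADT2006, Ch. I, Cor. 2.3] [cite: CasselsFrohlichANT1967, Ch. VI §1.1] -/
theorem invWeilPairing_conjActPlace {v w : HeightOneSpectrum (𝓞 K)} (h : σ • v = w)
    (hτe : ∀ S T, liftAutPlace σ h (e S T) =
      e ((isLiftOfAut_liftAutPlace σ h).torsionMap W N S)
        ((isLiftOfAut_liftAutPlace σ h).torsionMap W N T))
    (x y : galoisCohomology (((W.baseChange K).torsionGaloisModule N).toLocal (Sum.inr v : Place K)) 1) :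
    invWeilPairing (W.baseChange K) N e hμ hadd₁ hadd₂ hgal inv (Sum.inr w) (conjActPlace W σ N h x)
        (conjActPlace W σ N h y) =
      invWeilPairing (W.baseChange K) N e hμ hadd₁ hadd₂ hgal inv (Sum.inr v) x y := by
  haveI : CompactSpace (absoluteGaloisGroup (v.adicCompletion K)) := absoluteGaloisGroup_compactSpace _
  haveI : CompactSpace (absoluteGaloisGroup (w.adicCompletion K)) := absoluteGaloisGroup_compactSpace _
  rw [invWeilPairing_apply, invWeilPairing_apply,
    ← localTatePairingZMod_map_weilDual (W.baseChange K) N e hμ hadd₁ hadd₂ hgal (Sum.inr w) (inv (Sum.inr w)),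
    ← localTatePairingZMod_map_weilDual (W.baseChange K) N e hμ hadd₁ hadd₂ hgal (Sum.inr v) (inv (Sum.inr v))]
  have h1 := map_weilDual_conjActPlace W σ N e hμ hadd₁ hadd₂ hgal h hτe y
  have h2 := localTatePairingZMod_conjActPlace W σ N N inv hinv h x
    (galoisCohomology.map ((weilDualIntertwining (W.baseChange K) N e hμ hadd₁ hadd₂ hgal).restrictField
      (v.adicCompletion K)) 1 y)
  change localTatePairingZMod ((W.baseChange K).torsionGaloisModule N) N (Sum.inr w : Place K) (inv (Sum.inr w))
      (conjActPlace W σ N h x)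
      (galoisCohomology.map ((weilDualIntertwining (W.baseChange K) N e hμ hadd₁ hadd₂ hgal).restrictField
        (w.adicCompletion K)) 1 (conjActPlace W σ N h y)) =
    localTatePairingZMod ((W.baseChange K).torsionGaloisModule N) N (Sum.inr v : Place K) (inv (Sum.inr v)) x
      (galoisCohomology.map ((weilDualIntertwining (W.baseChange K) N e hμ hadd₁ hadd₂ hgal).restrictField
        (v.adicCompletion K)) 1 y)
  rw [h1, h2]

end Summit.BirchSwinnertonDyer.BirchSwinnertonDyer.Theorems.KolyvaginAtTwo.RegularRefill

end
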